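import Literature.MathematicalPhysics.QuantumLattice.WilsonBlockHeatBath
import Literature.MathematicalPhysics.QuantumLattice.TorusWilsonGibbs
import Mathlib.MeasureTheory.Function.FactorsThrough
import HarnessLib

/-!
# Markov property of the overlapping block heat-bath sampler of the torus Wilson theory

Theorems only (no definitions) about the vocabulary of
`Literature/MathematicalPhysics/QuantumLattice/WilsonBlockHeatBath.lean` (blocks `B_z`, link σ-algebras
`linkSigma S = 𝓕_S`, exterior σ-algebras `extSigma z = 𝓕_{B_zᶜ}` of the `m⁴` overlapping blocks of the torus `(ℤ/N)⁴`):

* `linkSigma_eq_cylinderEvents` — `𝓕_S` is Mathlib's cylinder σ-algebra; monotonicity, `𝓕_S ≤ 𝓕`, nesting of patch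
  and block exteriors; `𝓕_S`-measurable functions are exactly the measurable functions reading only the links in `S`
  (Doob–Dynkin, Mathlib `StronglyMeasurable.factorsThrough`);
* geometry of the overlapping blocks: consecutive torus coordinates lie in equal or consecutive cells
  (`cellOf_add_one`), every site lies in some block (`exists_inBlock`), and two blocks whose indices differ by more than
  `2` (cyclically) in some axis are never touched by a common plaquette (`not_inBlock_of_far`);
* **the Markov property** (`aestronglyMeasurable_condExp_extSigma_far`): for such a far pair `z, w` and a bounded
  measurable `F` not reading the links of `B_w`, the heat-bath average `μ[F | 𝓕_{B_zᶜ}]` of the Wilson state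
  `μ = wilsonMeasure ρ β` reads neither the links of `B_z` nor those of `B_w` — the DLR kernel of the plaquette
  specification (tree `TorusWilsonGibbs`) integrates the links of `B_z` against a weight involving only plaquettes
  touching `B_z`, none of which touches `B_w` (Martinelli 1999 §3: block heat-bath kernels of a finite-range Gibbs field
  commute at distance larger than the range; Georgii 2011 (2.11)).

References: F. Martinelli, *Lectures on Glauber dynamics for discrete spin models*, LNM 1717 (1999), §2.1, §3;
H.-O. Georgii, *Gibbs Measures and Phase Transitions* (2011), §1.2, (2.11). Deliberately NOT here: the `L²` operators,
spectral gaps, the product-measure structure (`WilsonBlockHeatBathMarkov2.lean`).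
-/

noncomputable section

open MeasureTheory
open Literature.MathematicalPhysics.QuantumFieldTheory
open Literature.Probability.LatticeModels

namespace Literature.MathematicalPhysics.QuantumLattice.WilsonBlockHeatBath

/-! ### Link σ-algebras -/

section Sigma

variable {G : Type} [MeasurableSpace G] {N : ℕ}

/-- The link σ-algebra `𝓕_S` generated by the link variables in `S` is Mathlib's cylinder σ-algebra of the
coordinate set `S` (Martinelli 1999 §2.1; Georgii 2011 §1.2). [cite: Martinelli1999, §2.1] -/
theorem linkSigma_eq_cylinderEvents (S : Set (Edge 4 N)) :
    linkSigma (G := G) S = cylinderEvents (X := fun _ : Edge 4 N => G) S := by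
  unfold linkSigma cylinderEvents
  rw [MeasurableSpace.pi, MeasurableSpace.comap_iSup, iSup_subtype']
  refine iSup_congr fun _ => ?_
  rw [MeasurableSpace.comap_comp]
  rfl

/-- `𝓕_S` is a sub-σ-algebra of the product σ-algebra of all links. [folklore] -/
theorem linkSigma_le (S : Set (Edge 4 N)) :
    linkSigma (G := G) S ≤ (inferInstance : MeasurableSpace (GaugeConfig 4 N G)) := by
  rw [linkSigma_eq_cylinderEvents]; exact cylinderEvents_le_pi

/-- `𝓕_S` is monotone in the link set `S`. [folklore] -/
theorem linkSigma_mono {S T : Set (Edge 4 N)} (h : S ⊆ T) : linkSigma (G := G) S ≤ linkSigma T := by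
  rw [linkSigma_eq_cylinderEvents, linkSigma_eq_cylinderEvents]; exact cylinderEvents_mono h

/-- The σ-algebra of all links is the ambient product σ-algebra. [folklore] -/
theorem linkSigma_univ :
    linkSigma (G := G) (Set.univ : Set (Edge 4 N)) = (inferInstance : MeasurableSpace (GaugeConfig 4 N G)) := by
  rw [linkSigma_eq_cylinderEvents, cylinderEvents_univ]

/-- The exterior σ-algebra of a patch is contained in the exterior σ-algebra of each of its blocks (fewer generating
links). [folklore] -/
theorem patchExtSigma_le_extSigma {m n₀ : ℕ} {ζ z : Fin 4 → Fin m} (h : InPatch n₀ ζ z) :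
    patchExtSigma G N m n₀ ζ ≤ extSigma G N m z :=
  linkSigma_mono fun _ he => he z h

/-- An `𝓕_S`-measurable real function reads only the links in `S` (Doob–Dynkin; Georgii 2011 §1.2).
[cite: Georgii2011, §1.2] -/
theorem dependsOn_of_stronglyMeasurable_linkSigma {S : Set (Edge 4 N)} {g : GaugeConfig 4 N G → ℝ}
    (hg : StronglyMeasurable[linkSigma S] g) : DependsOn g S :=
  dependsOn_iff_factorsThrough.2 hg.factorsThrough

/-- A measurable real function reading only the links in `S` is `𝓕_S`-measurable (Georgii 2011 §1.2).
[cite: Georgii2011, §1.2] -/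
theorem measurable_linkSigma_of_dependsOn {S : Set (Edge 4 N)} {g : GaugeConfig 4 N G → ℝ}
    (hg : Measurable g) (h : DependsOn g S) : Measurable[linkSigma S] g := by
  rw [linkSigma_eq_cylinderEvents]; exact hg.measurable_cylinderEvents_of_dependsOn h

end Sigma

/-! ### Geometry of the overlapping blocks -/

section Geometry

variable {N m : ℕ}

/-- Consecutive torus coordinates lie in the same or in consecutive cells (cyclically): for `1 ≤ m ≤ N`,
`cellOf (a + 1) ∈ {cellOf a, cellOf a + 1}` in `ℤ/m` (the last cell `m − 1` of `a = N − 1` is followed by the cell `0`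
of `a + 1 = 0`). [folklore] -/
theorem cellOf_add_one [NeZero N] (h1 : 1 ≤ m) (hmN : m ≤ N) (a : ZMod N) :
    cellOf N m (a + 1) = cellOf N m a ∨ cellOf N m (a + 1) = cellOf N m a + 1 := by
  have hN : 0 < N := NeZero.pos N
  unfold cellOf
  by_cases ha : a.val + 1 < N
  · have hN1 : N ≠ 1 := by
      intro h; subst h; have := a.val_lt; omega
    have hval : (a + 1).val = a.val + 1 := by
      rw [ZMod.val_add_of_lt (by rwa [ZMod.val_one'' hN1]), ZMod.val_one'' hN1]
    rw [hval]
    have hle : a.val * m / N ≤ (a.val + 1) * m / N :=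
      Nat.div_le_div_right (Nat.mul_le_mul_right _ (Nat.le_succ _))
    have hle' : (a.val + 1) * m / N ≤ a.val * m / N + 1 := by
      calc (a.val + 1) * m / N = (a.val * m + m) / N := by rw [Nat.add_mul, one_mul]
        _ ≤ (a.val * m + N) / N := Nat.div_le_div_right (by omega)
        _ = a.val * m / N + 1 := Nat.add_div_right _ hN
    rcases Nat.eq_or_lt_of_le hle with h | h
    · left; rw [← h]
    · right
      rw [le_antisymm hle' h]; push_cast; ring
  · right
    have hav : a.val + 1 = N := by have := a.val_lt; omega
    have ha1 : a + 1 = 0 := by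
      rw [← ZMod.natCast_zmod_val a, ← Nat.cast_one, ← Nat.cast_add, hav, ZMod.natCast_self]
    rw [ha1, ZMod.val_zero, zero_mul, Nat.zero_div]
    have hq : a.val * m / N = m - 1 := by
      rw [show a.val = N - 1 by omega]
      have : (N - 1) * m = (m - 1) * N + (N - m) := by zify [h1, hmN, hN]; ring
      rw [this, Nat.add_comm, Nat.add_mul_div_right _ _ hN, Nat.div_eq_of_lt (by omega), zero_add]
    rw [hq, Nat.cast_sub h1, Nat.cast_one, sub_add_cancel, ZMod.natCast_self, Nat.cast_zero]

/-- The cyclic representative of an integer of absolute value `≤ k` has absolute value `≤ k`. [folklore] -/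
theorem natAbs_valMinAbs_intCast_le [NeZero m] (ι : ℤ) :
    ((ι : ZMod m).valMinAbs).natAbs ≤ ι.natAbs :=
  ZMod.natAbs_min_of_le_div_two m _ _ (ZMod.coe_valMinAbs _) (ZMod.natAbs_valMinAbs_le _)

/-- **Blocks at cyclic index distance `≥ 3` are a full cell apart.** If the coordinates `s₁, s₂ ∈ {c, c + 1}` of two
neighbouring sites lie in the clusters `{z, z+1}` resp. `{w, w+1}` of cells, then the block indices `z, w` differ by at
most `2` around `ℤ/m`. [folklore] -/
theorem natAbs_valMinAbs_le_two_of_cells [NeZero N] [NeZero m] (hmN : m ≤ N) (c s₁ s₂ : ZMod N)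
    (h₁ : s₁ = c ∨ s₁ = c + 1) (h₂ : s₂ = c ∨ s₂ = c + 1) (z w : ZMod m)
    (hz : (cellOf N m s₁ - z).val ≤ 1) (hw : (cellOf N m s₂ - w).val ≤ 1) :
    ((z - w).valMinAbs).natAbs ≤ 2 := by
  have h1m : 1 ≤ m := NeZero.one_le
  have hcell : ∀ s : ZMod N, (s = c ∨ s = c + 1) →
      ∃ ε : ℕ, ε ≤ 1 ∧ cellOf N m s = cellOf N m c + (ε : ZMod m) := by
    intro s hs
    rcases hs with rfl | rfl
    · exact ⟨0, zero_le_one, by simp⟩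
    · rcases cellOf_add_one h1m hmN c with h | h
      · exact ⟨0, zero_le_one, by simp [h]⟩
      · exact ⟨1, le_rfl, by simp [h]⟩
  have hval : ∀ x y : ZMod m, (x - y).val ≤ 1 → ∃ v : ℕ, v ≤ 1 ∧ x = y + (v : ZMod m) :=
    fun x y h => ⟨(x - y).val, h, by rw [ZMod.natCast_zmod_val]; ring⟩
  obtain ⟨ε₁, hε₁, e₁⟩ := hcell s₁ h₁
  obtain ⟨ε₂, hε₂, e₂⟩ := hcell s₂ h₂
  obtain ⟨v₁, hv₁, f₁⟩ := hval _ _ hz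
  obtain ⟨v₂, hv₂, f₂⟩ := hval _ _ hw
  have hz' : z = cellOf N m c + (ε₁ : ZMod m) - (v₁ : ZMod m) := by rw [← e₁, f₁]; ring
  have hw' : w = cellOf N m c + (ε₂ : ZMod m) - (v₂ : ZMod m) := by rw [← e₂, f₂]; ring
  have hzw : z - w = (((ε₁ : ℤ) - v₁ - ε₂ + v₂ : ℤ) : ZMod m) := by rw [hz', hw']; push_cast; ring
  rw [hzw]
  refine (natAbs_valMinAbs_intCast_le _).trans ?_
  omega

/-- The coordinates of the shifted site `y + eᵢ` are `y k` or `y k + 1`. [folklore] -/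
theorem shift_apply_eq_or (y : Site 4 N) (i k : Fin 4) : y.shift i k = y k ∨ y.shift i k = y k + 1 := by
  simp only [QuantumFieldTheory.Site.shift, Pi.add_apply, Pi.single_apply]
  split_ifs <;> simp

/-- **Far blocks are not touched by a common plaquette.** If two block indices differ cyclically by more than `2` in
some axis, then no two sites with coordinates in `{y k, y k + 1}` (in particular no two corners of a plaquette based at
`y`) lie one in each block (`1 ≤ m ≤ N` cells per axis). [folklore] -/
theorem not_inBlock_of_far [NeZero N] [NeZero m] (hmN : m ≤ N) {z w : Fin 4 → Fin m}
    (hfar : ∃ k, 2 < ((((z k : ℕ) : ZMod m) - ((w k : ℕ) : ZMod m)).valMinAbs).natAbs)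
    {y s₁ s₂ : Site 4 N} (h₁ : ∀ k, s₁ k = y k ∨ s₁ k = y k + 1) (h₂ : ∀ k, s₂ k = y k ∨ s₂ k = y k + 1)
    (hz : InBlock N m z s₁) : ¬ InBlock N m w s₂ := by
  intro hw
  obtain ⟨k, hk⟩ := hfar
  exact absurd (natAbs_valMinAbs_le_two_of_cells hmN (y k) (s₁ k) (s₂ k) (h₁ k) (h₂ k) _ _ (hz k) (hw k))
    (not_le.2 hk)

/-- **The blocks cover the torus**: every site lies in the block indexed by the cells of its coordinates. [folklore] -/
theorem exists_inBlock [NeZero m] (x : Site 4 N) : ∃ z : Fin 4 → Fin m, InBlock N m z x := by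
  refine ⟨fun k => ⟨(cellOf N m (x k)).val, ZMod.val_lt _⟩, fun k => ?_⟩
  simp only [ZMod.natCast_val, ZMod.cast_id', id_eq, sub_self, ZMod.val_zero, zero_le_one]

end Geometry

/-! ### The Markov property of the block heat-bath kernels -/

section Markov

variable {G : Type} [Group G] [TopologicalSpace G] [IsTopologicalGroup G] [CompactSpace G]
  [MeasurableSpace G] [BorelSpace G] [T2Space G] [SecondCountableTopology G] {Nρ : ℕ}
  (ρ : G →* Matrix (Fin Nρ) (Fin Nρ) ℂ) {N : ℕ} [NeZero N]

/-- **Markov property of the block heat-bath projections** (Martinelli 1999 §3, finite-range block dynamics; Georgii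
2011 (2.11) with Rem. 1.24): let `z, w` be block indices differing cyclically by more than `2` in some axis
(`1 ≤ m ≤ N` cells per axis) and let `F` be a bounded measurable function not reading the links of `B_w`. Then the
block heat-bath average `μ[F | 𝓕_{B_zᶜ}]` of the torus Wilson state `μ = wilsonMeasure ρ β` is a.e. equal to a function
reading neither the links of `B_z` nor those of `B_w`: it has the version `η ↦ ∫ F dγ_{B_z}(· | η)` (DLR kernel of the
plaquette specification, tree `isGibbsMeasure_wilsonMeasure`), which integrates out the links of `B_z` against a weight
made of plaquettes touching `B_z`, and no plaquette touches both `B_z` and `B_w` (`not_inBlock_of_far`).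
[cite: Martinelli1999, §3] -/
theorem aestronglyMeasurable_condExp_extSigma_far (hρ : Continuous ρ) (β : ℝ) {m : ℕ} [NeZero m]
    (hmN : m ≤ N) {z w : Fin 4 → Fin m}
    (hfar : ∃ k, 2 < ((((z k : ℕ) : ZMod m) - ((w k : ℕ) : ZMod m)).valMinAbs).natAbs)
    {F : GaugeConfig 4 N G → ℝ} (hFm : Measurable F) {B : ℝ} (hB : ∀ U, |F U| ≤ B)
    (hF : DependsOn F {e : Edge 4 N | ¬ InBlock N m w e.1}) :
    AEStronglyMeasurable[linkSigma {e : Edge 4 N | ¬ InBlock N m z e.1 ∧ ¬ InBlock N m w e.1}]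
      ((wilsonMeasure (d := 4) (L := N) ρ β)[F | extSigma G N m z]) (wilsonMeasure (d := 4) (L := N) ρ β) := by
  classical
  obtain ⟨Φ, supp, hΦ, hΦb, hsupp, hH, hplaq⟩ := exists_plaquettePotential (d := 4) (L := N) ρ hρ
  have hμ := isGibbsMeasure_wilsonMeasure ρ hρ hΦ hΦb hsupp hH β
  set Λ : Finset (Edge 4 N) := Finset.univ.filter fun e => InBlock N m z e.1 with hΛ
  set T : Set (Edge 4 N) := {e | ¬ InBlock N m z e.1 ∧ ¬ InBlock N m w e.1} with hT
  have hmemΛ : ∀ e, e ∈ Λ ↔ InBlock N m z e.1 := fun e => by simp [hΛ]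
  have hΛc : ((↑Λ : Set (Edge 4 N))ᶜ) = {e | ¬ InBlock N m z e.1} := by
    ext e; simp [hmemΛ]
  -- corners of a plaquette based at `y`
  have hcorner : ∀ (y : Site 4 N) (i j : Fin 4) (e : Edge 4 N),
      e ∈ ({(y, i), (y.shift i, j), (y.shift j, i), (y, j)} : Finset (Edge 4 N)) →
        ∀ k, e.1 k = y k ∨ e.1 k = y k + 1 := by
    intro y i j e he k
    simp only [Finset.mem_insert, Finset.mem_singleton] at he
    rcases he with rfl | rfl | rfl | rfl
    · exact Or.inl rfl
    · exact shift_apply_eq_or y i k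
    · exact shift_apply_eq_or y j k
    · exact Or.inl rfl
  have hTΛ : ∀ A ∈ supp Λ, (A ∩ Λ).Nonempty → (↑A : Set (Edge 4 N)) ⊆ ↑Λ ∪ T := by
    intro A hA hne e he
    obtain ⟨y, i, j, -, rfl⟩ := hplaq Λ A hA
    obtain ⟨e₀, he₀⟩ := hne
    rw [Finset.mem_inter, hmemΛ] at he₀
    by_cases hze : InBlock N m z e.1
    · exact Or.inl (by simpa [hmemΛ] using hze)
    · exact Or.inr ⟨hze, not_inBlock_of_far hmN hfar (hcorner y i j e₀ he₀.1) (hcorner y i j e he) he₀.2⟩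
  have hF' : DependsOn F (↑Λ ∪ T) := hF.mono fun e he => by
    by_cases hze : InBlock N m z e.1
    · exact Or.inl (by simpa [hmemΛ] using hze)
    · exact Or.inr ⟨hze, he⟩
  obtain ⟨hsm, hae⟩ := stronglyMeasurable_and_ae_eq_condExp_integral_gibbsSpecOfPotential (haarProbability G)
    hΦ hΦb hsupp β hμ Λ hTΛ hFm hB hF'
  refine ⟨fun η => ∫ σ, F σ ∂(gibbsSpecOfPotential (haarProbability G) Φ supp β Λ η), ?_, ?_⟩
  · rw [linkSigma_eq_cylinderEvents]; exact hsm
  · rw [hΛc, ← linkSigma_eq_cylinderEvents] at hae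
    exact hae.symm

omit [T2Space G] [SecondCountableTopology G] in
/-- **A bounded local version of a heat-bath average**: the conditional expectation `μ[F | 𝓕_S]` of a bounded
measurable `F` given the links in `S` has a bounded (same bound) measurable version reading only the links in `S`
(truncation of the `𝓕_S`-measurable conditional expectation at the bound of `F`); for `S = B_wᶜ` this is the block
heat-bath average of `F` (Martinelli 1999 §3, the block heat-bath kernel is a Markov operator). [cite: Martinelli1999, §3] -/
theorem exists_version_condExp_linkSigma (β : ℝ) (S : Set (Edge 4 N)) {F : GaugeConfig 4 N G → ℝ}
    {B : ℝ} (hB : ∀ U, |F U| ≤ B) :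
    ∃ F₁ : GaugeConfig 4 N G → ℝ, Measurable F₁ ∧ (∀ U, |F₁ U| ≤ B) ∧ DependsOn F₁ S ∧
      F₁ =ᵐ[wilsonMeasure (d := 4) (L := N) ρ β] (wilsonMeasure (d := 4) (L := N) ρ β)[F | linkSigma S] := by
  set μ := wilsonMeasure (d := 4) (L := N) ρ β with hμ
  have hB0 : 0 ≤ B := (abs_nonneg _).trans (hB fun _ => 1)
  set h := μ[F | linkSigma S] with hh
  have hsm : StronglyMeasurable[linkSigma S] h := stronglyMeasurable_condExp
  refine ⟨fun U => max (-B) (min (h U) B), ?_, fun U => ?_, ?_, ?_⟩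
  · have : Measurable h := (hsm.mono (linkSigma_le _)).measurable
    exact measurable_const.max (this.min measurable_const)
  · exact abs_le.2 ⟨le_max_left _ _, max_le (by linarith) (min_le_right _ _)⟩
  · have hdep := dependsOn_of_stronglyMeasurable_linkSigma hsm
    exact fun U V hUV => by simp only [hdep hUV]
  · have hbdd : ∀ᵐ U ∂μ, |h U| ≤ B := ae_bdd_abs_condExp_of_ae_bdd_abs (ae_of_all _ fun U => hB U)
    filter_upwards [hbdd] with U hU
    rw [abs_le] at hU
    rw [min_eq_left hU.2, max_eq_right hU.1]

end Markov

end Literature.MathematicalPhysics.QuantumLattice.WilsonBlockHeatBath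

end
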